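import Summits.CriticalPhenomena.CardyFormulaZ2.Theorems.CardyComplexConeEdgePrecompactUFRSLastDeparture
import Summits.CriticalPhenomena.CardyFormulaZ2.Theorems.CardyComplexConeEdgePrecompactUFRSAnnulusCrossings

/-!
# The return journey of the exploration and the exit corner of the translate (tools for the UFRS arm domination)
(line `qkz-strip-boundary-arm` of crux `CardyComplexCone.EdgePrecompact`, stmt-CriticalPhenomena-11387;
deterministic assembly of the corrected item (H₁) `ufrs_armDomination2` of the road map for the
uniform forward response stability "UFRS")

In the FACE case and in the "run ends at the exit corner of the translate" case of the UFRS
failure analysis (`ufrs_faceExit`, `ufrs_lastDeparture` (4)), and whenever the start pair is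
involved, the second long strand of the certificate at the collar point is the RETURN JOURNEY of
the exploration of `E`: after its first entry into the ball the completed orbit of the start
corner `a` goes on through inner faces of `E` and leaves them exactly at THE exit corner of `E`
(`cornerOrbit_exit`, `exitCorner_unique`), which is the translate by `-w` of the exit corner of
`shiftData E w`. This file packages these facts:

* `exists_explorationExit_W3H` — for admissible `E` and a start corner `a`: an exit index `N` with
  inner faces up to `N`, a non-inner face at `N + 1`, pairwise distinct corners on `[0, N]`, and
  `O a N` exit-type (vertex on `A`, target edge an `A`–`B` edge read at its `A`-end);
* `isInEdge_shiftData_iff_W3H`, `exitType_sub_shift_W3H` — exit-type corners of `shiftData E w` are the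
  translates of exit-type corners of `E`; `dist_meshPoint_sub_shift_W3H`;
* `exists_returnJourney_W3H` — the exploration of `E` from the start corner exits, after its entry
  into the ball, at the translate by `-w` of any exit-type corner of `shiftData E w`;
  `runEnd_exitType_W3H` — a run of the translate's dynamics which leaves the inner faces does so at
  the exit corner of the translate (`orbit_exit_or_stuck`, stuck alternative excluded);
  `ufrs_returnJourney` is the registered `∀`-form of `exists_returnJourney_W3H`;
* `deep_of_cTgt_mem_ball_W3H`, `far_of_near_cTgt_mem_ball_W3H` — a corner whose target midpoint lies in
  the `2ρ`-deep ball `B(E.δ v, ρ)` is `3η`-deep, and every vertex within `E.δ` of it is at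
  distance `> ρ - 3η - 2 E.δ` from every point of the `3η`-collar;
* `stretch_ne_of_lt_W3H` — simplicity of a stretch in the `s < t → ≠` format of `ufrsStrands`.

References: S. Smirnov, C. R. Acad. Sci. Paris 333 (2001), §2 (the exploration path runs from
`e_a` to `e_b`); G. Grimmett, *Percolation* (1999), §11.2.
-/

namespace Summit.CriticalPhenomena.CardyFormulaZ2.Cruxes.EdgePrecompact.QkzStripBoundaryArm

open MeasureTheory Filter Set Metric
open scoped Topology BigOperators Pointwise
open Literature.Probability.LatticeModels Literature.Probability.Percolation
open Literature.Probability.RandomPlanarGeometry (DobrushinDomain)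
open Summit.CriticalPhenomena.CardyFormulaZ2.Theses.CardyComplexCone

noncomputable section

/-! ## The exit of the exploration -/

/-- **The exploration of admissible data exits at the exit corner.** For admissible `E`, a
configuration `ω` and a start corner `a`, there is an exit index `N`: the faces of `O a t` are
inner for `t ≤ N` and not at `N + 1`, the corners `O a 0, …, O a N` are pairwise distinct, and
`O a N` is exit-type — its vertex lies on the arc `A`, the other endpoint of its target edge on
the arc `B`, the target edge is targeted at the vertex (`IsInEdge`), closed, and an `A`–`B`
edge. -/
theorem exists_explorationExit_W3H {E : DiscreteDobrushin} (hE : E.IsZdAdmissible) (ω : BondConfig (Site 2))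
    {a : Site 2 × Fin 4} (ha : E.IsStartCorner a) :
    ∃ N : ℕ, (∀ t ≤ N, E.IsInnerFace (cFace (cornerOrbit (E.bcBondConfig ω) a t))) ∧
      ¬ E.IsInnerFace (cFace (cornerOrbit (E.bcBondConfig ω) a (N + 1))) ∧
      (∀ s t, s < t → t ≤ N → cornerOrbit (E.bcBondConfig ω) a s ≠ cornerOrbit (E.bcBondConfig ω) a t) ∧
      cTgt (cornerOrbit (E.bcBondConfig ω) a N) ∉ E.bcBondConfig ω ∧
      (cornerOrbit (E.bcBondConfig ω) a N).1 ∈ E.zdArcA ∧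
      (cornerOrbit (E.bcBondConfig ω) a N).1 + cornerUnit ((cornerOrbit (E.bcBondConfig ω) a N).2 + 1) ∈ E.zdArcB ∧
      E.IsInEdge (cornerOrbit (E.bcBondConfig ω) a N).1 ((cornerOrbit (E.bcBondConfig ω) a N).2 + 1) ∧
      cTgt (cornerOrbit (E.bcBondConfig ω) a N) ∈ E.zdABEdges := by
  classical
  have hex := exists_not_isInnerFace_cornerOrbit (ω := ω) hE ha
  -- the first non-inner index is positive: the face of the start corner is inner
  have h0 : Nat.find hex ≠ 0 := by
    intro h
    have := Nat.find_spec hex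
    rw [h] at this
    exact this ha.isOutEdge.1
  obtain ⟨N, hN⟩ : ∃ N, Nat.find hex = N + 1 := ⟨Nat.find hex - 1, by omega⟩
  have hinner : ∀ t ≤ N, E.IsInnerFace (cFace (cornerOrbit (E.bcBondConfig ω) a t)) := by
    intro t ht
    have := Nat.find_min hex (m := t) (by omega)
    exact not_not.1 this
  have hout : ¬ E.IsInnerFace (cFace (cornerOrbit (E.bcBondConfig ω) a (N + 1))) := by
    have := Nat.find_spec hex
    rwa [hN] at this
  obtain ⟨hclosed, hA, hB, hIn⟩ := cornerOrbit_exit hE ha (hinner N le_rfl) hout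
  exact ⟨N, hinner, hout, fun s t hst htN => cornerOrbit_ne hE ha hst (fun k hk => hinner k (by omega)),
    hclosed, hA, hB, hIn, cTgt_exit_mem_zdABEdges hE ha (hinner N le_rfl) hout⟩

/-! ## Exit-type corners under translation -/

/-- Targeted face-boundary edges of the translated data are the translated ones. -/
theorem isInEdge_shiftData_iff_W3H (E : DiscreteDobrushin) (w x : Site 2) (k : Fin 4) :
    (shiftData E w).IsInEdge (x + w) k ↔ E.IsInEdge x k := by
  unfold DiscreteDobrushin.IsInEdge
  rw [faceAt_add, faceAt_add, isInnerFace_shiftData_iff, isInnerFace_shiftData_iff]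

/-- **Exit-type corners of the translate are translated exit-type corners**: if `q` is
exit-type for `shiftData E w` (vertex on `A₁`, target edge ending on `B₁`, targeted at the
vertex), then `(q.1 - w, q.2)` is exit-type for `E`. -/
theorem exitType_sub_shift_W3H {E : DiscreteDobrushin} {w : Site 2} {q : Site 2 × Fin 4}
    (hA : q.1 ∈ (shiftData E w).zdArcA) (hB : q.1 + cornerUnit (q.2 + 1) ∈ (shiftData E w).zdArcB)
    (hIn : (shiftData E w).IsInEdge q.1 (q.2 + 1)) :
    (q.1 - w) ∈ E.zdArcA ∧ (q.1 - w) + cornerUnit (q.2 + 1) ∈ E.zdArcB ∧ E.IsInEdge (q.1 - w) (q.2 + 1) := by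
  have hq : q.1 - w + w = q.1 := sub_add_cancel q.1 w
  refine ⟨(mem_zdArcA_shiftData_iff E w (q.1 - w)).1 (by rw [hq]; exact hA),
    (mem_zdArcB_shiftData_iff E w _).1 ?_, (isInEdge_shiftData_iff_W3H E w (q.1 - w) (q.2 + 1)).1 (by rw [hq]; exact hIn)⟩
  rw [add_right_comm, hq]
  exact hB

/-- The mesh points of a site and of its translate by `-w` are at distance `‖E.δ w‖`. -/
theorem dist_meshPoint_sub_shift_W3H (δ : ℝ) (w x : Site 2) :
    dist (meshPoint δ (x - w)) (meshPoint δ x) = ‖meshPoint δ w‖ := by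
  rw [meshPoint_sub_shift, dist_eq_norm, sub_sub_cancel_left, norm_neg]

/-! ## Depth and distance of the ball's corners -/

/-- A corner whose TARGET edge has its midpoint in the ball `B(E.δ v, ρ)` (`2ρ`-deep centre,
`4η ≤ ρ`, `E.δ ≤ η`) has a `3η`-deep vertex. -/
theorem deep_of_cTgt_mem_ball_W3H {E : DiscreteDobrushin} {Ω : Set ℂ} {v : Site 2} {ρ η : ℝ}
    (hδ : 0 ≤ E.δ) (hδη : E.δ ≤ η) (hηρ : 4 * η ≤ ρ) (hv : 2 * ρ ≤ infDist (meshPoint E.δ v) Ωᶜ)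
    {p : Site 2 × Fin 4} (hp : medialPoint E.δ (cTgt p) ∈ ball (meshPoint E.δ v) ρ) :
    3 * η ≤ infDist (meshPoint E.δ p.1) Ωᶜ := by
  have h1 := dist_medialPoint_cTgt_le' hδ p
  have h2 := dist_triangle (meshPoint E.δ p.1) (medialPoint E.δ (cTgt p)) (meshPoint E.δ v)
  rw [dist_comm] at h1
  rw [mem_ball] at hp
  have h3 := infDist_le_infDist_add_dist (x := meshPoint E.δ v) (y := meshPoint E.δ p.1) (s := Ωᶜ)
  rw [dist_comm] at h3
  linarith

/-- **Vertices next to the ball entry are far from the collar.** If `z` is within `s` of a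
collar point (`infDist · Ωᶜ < 3η`), the corner `p` has its target midpoint in the `2ρ`-deep
ball `B(E.δ v, ρ)`, and the site `y` is within `E.δ` of the vertex of `p`, then
`dist (E.δ y) z > ρ - 3η - 2 E.δ - s`. -/
theorem far_of_near_cTgt_mem_ball_W3H {E : DiscreteDobrushin} {Ω : Set ℂ} {v x y : Site 2} {ρ η s : ℝ}
    (hδ : 0 ≤ E.δ) (hv : 2 * ρ ≤ infDist (meshPoint E.δ v) Ωᶜ) (hx : infDist (meshPoint E.δ x) Ωᶜ < 3 * η)
    {z : ℂ} (hz : dist z (meshPoint E.δ x) ≤ s) {p : Site 2 × Fin 4}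
    (hp : medialPoint E.δ (cTgt p) ∈ ball (meshPoint E.δ v) ρ)
    (hy : dist (meshPoint E.δ y) (meshPoint E.δ p.1) ≤ E.δ) :
    ρ - 3 * η - 2 * E.δ - s < dist (meshPoint E.δ y) z := by
  have hfar := far_of_cTgt_mem_ball (E := E) hδ hv hx hp
  have h1 := dist_triangle (meshPoint E.δ p.1) (meshPoint E.δ y) z
  have h2 := dist_triangle (meshPoint E.δ p.1) z (meshPoint E.δ x)
  rw [dist_comm] at hy
  linarith


/-! ## The return journey and the end of the second run -/

/-- **The return journey of the exploration.** For admissible `E`, a start corner `a` whose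
orbit runs through inner faces up to time `n` and sits at time `n` at a vertex all of whose
faces are inner (a deep vertex), and an exit-type corner `q` of the translate `shiftData E w`:
the exploration of `E` from `a` exits at an index `N > n`, through inner faces and pairwise
distinct corners up to `N`, and its exit corner `O a N` is the translate `(q.1 - w, q.2)` of
`q` (`exitType_sub_shift_W3H`, `exitCorner_unique`). The stretch `O a [n + 1, N]` is the return
journey from the ball to the marked point. -/
theorem exists_returnJourney_W3H {E : DiscreteDobrushin} (hE : E.IsZdAdmissible) (ω : BondConfig (Site 2))
    {w : Site 2} {a q : Site 2 × Fin 4} (ha : E.IsStartCorner a) {n : ℕ}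
    (hStr : ∀ t < n, E.IsInnerFace (cFace (cornerOrbit (E.bcBondConfig ω) a (t + 1))))
    (hdeep : ∀ f, IsCorner (cornerOrbit (E.bcBondConfig ω) a n).1 f → E.IsInnerFace f)
    (hqA : q.1 ∈ (shiftData E w).zdArcA) (hqB : q.1 + cornerUnit (q.2 + 1) ∈ (shiftData E w).zdArcB)
    (hqIn : (shiftData E w).IsInEdge q.1 (q.2 + 1)) :
    ∃ N : ℕ, n < N ∧ (∀ t ≤ N, E.IsInnerFace (cFace (cornerOrbit (E.bcBondConfig ω) a t))) ∧
      (∀ s t, s < t → t ≤ N → cornerOrbit (E.bcBondConfig ω) a s ≠ cornerOrbit (E.bcBondConfig ω) a t) ∧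
      cornerOrbit (E.bcBondConfig ω) a N = (q.1 - w, q.2) := by
  obtain ⟨N, hNin, hNout, hNne, -, hNA, hNB, hNIn, -⟩ := exists_explorationExit_W3H hE ω ha
  obtain ⟨hA', hB', hIn'⟩ := exitType_sub_shift_W3H hqA hqB hqIn
  have hq : cornerOrbit (E.bcBondConfig ω) a N = (q.1 - w, q.2) := exitCorner_unique hE hNA hNB hNIn hA' hB' hIn'
  refine ⟨N, ?_, hNin, hNne, hq⟩
  rcases Nat.lt_or_ge n N with h | h
  · exact h
  · exfalso
    rcases Nat.lt_or_ge N n with h' | h'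
    · exact hNout (hStr N h')
    · have hNn : N = n := le_antisymm h h'
      rw [hNn] at hNIn
      exact hNIn.2 (hdeep _ (isCorner_faceAt _ _))

/-- **Where the second run leaves the inner faces of the translate: at its exit corner.** If the
completed orbit of the translate `shiftData E w` from a corner `a'` sits in an inner face at time
`K` and not at time `K + 1`, and `a'` is not stuck at an arc-`B` vertex (its vertex is off the
arc `B₁`, or all faces at its vertex are inner), then `O₁ a' K` is exit-type for the translate
and its target edge is a closed `A₁`–`B₁` edge. -/
theorem runEnd_exitType_W3H {E : DiscreteDobrushin} (hE : E.IsZdAdmissible) (ω : BondConfig (Site 2)) (w : Site 2)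
    {a' : Site 2 × Fin 4} {K : ℕ}
    (hin : (shiftData E w).IsInnerFace (cFace (cornerOrbit ((shiftData E w).bcBondConfig ω) a' K)))
    (hout : ¬ (shiftData E w).IsInnerFace (cFace (cornerOrbit ((shiftData E w).bcBondConfig ω) a' (K + 1))))
    (hgood : a'.1 ∉ (shiftData E w).zdArcB ∨ ∀ f, IsCorner a'.1 f → (shiftData E w).IsInnerFace f) :
    cTgt (cornerOrbit ((shiftData E w).bcBondConfig ω) a' K) ∉ (shiftData E w).bcBondConfig ω ∧
      (cornerOrbit ((shiftData E w).bcBondConfig ω) a' K).1 ∈ (shiftData E w).zdArcA ∧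
      (cornerOrbit ((shiftData E w).bcBondConfig ω) a' K).1 +
          cornerUnit ((cornerOrbit ((shiftData E w).bcBondConfig ω) a' K).2 + 1) ∈ (shiftData E w).zdArcB ∧
      (shiftData E w).IsInEdge (cornerOrbit ((shiftData E w).bcBondConfig ω) a' K).1
          ((cornerOrbit ((shiftData E w).bcBondConfig ω) a' K).2 + 1) ∧
      cTgt (cornerOrbit ((shiftData E w).bcBondConfig ω) a' K) ∈ (shiftData E w).zdABEdges := by
  have hE₁ : (shiftData E w).IsZdAdmissible := isZdAdmissible_shiftData E w hE
  rcases orbit_exit_or_stuck hE₁ ω a' hin hout with ⟨haB, hstay⟩ | h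
  · exfalso
    rcases hgood with h1 | h2
    · exact h1 haB
    · apply hout
      have hv1 : (cornerOrbit ((shiftData E w).bcBondConfig ω) a' (K + 1)).1 = a'.1 := hstay (K + 1) le_rfl
      have hc := isCorner_cFace (cornerOrbit ((shiftData E w).bcBondConfig ω) a' (K + 1))
      rw [hv1] at hc
      exact h2 _ hc
  · exact h

/-! ## Simplicity in the format of `ufrsStrands` -/

/-- From injectivity on `[0, n]` to the `s < t → ≠` format on a sub-interval. -/
theorem stretch_ne_of_lt_W3H {β : BondConfig (Site 2)} {c : Site 2 × Fin 4} {n : ℕ}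
    (hsimple : ∀ i₁ i₂ : ℕ, i₁ ≤ n → i₂ ≤ n → cornerOrbit β c i₁ = cornerOrbit β c i₂ → i₁ = i₂)
    {i j : ℕ} (hj : j ≤ n) : ∀ s t, i ≤ s → s < t → t ≤ j → cornerOrbit β c s ≠ cornerOrbit β c t := by
  intro s t _ hst htj h
  have := hsimple s t (by omega) (by omega) h
  omega

/-- **The return journey of the exploration** (registered sub-goal `ufrs_returnJourney` of
stmt-CriticalPhenomena-11387; the `∀`-form of `exists_returnJourney_W3H`): for admissible `E`, a
start corner `a` whose completed orbit runs through inner faces up to time `n` and sits at time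
`n` at a vertex all of whose faces are inner, and an exit-type corner `q` of `shiftData E w`, the
exploration of `E` from `a` exits at an index `N > n`, through inner faces and pairwise distinct
corners, at the corner `(q.1 - w, q.2)`. -/
theorem ufrs_returnJourney : ∀ (E : DiscreteDobrushin) (ω : BondConfig (Site 2)) (w : Site 2) (a q : Site 2 × Fin 4) (n : ℕ), E.IsZdAdmissible → E.IsStartCorner a → (∀ t < n, E.IsInnerFace (cFace (cornerOrbit (E.bcBondConfig ω) a (t + 1)))) → (∀ f, IsCorner (cornerOrbit (E.bcBondConfig ω) a n).1 f → E.IsInnerFace f) → q.1 ∈ (shiftData E w).zdArcA → q.1 + cornerUnit (q.2 + 1) ∈ (shiftData E w).zdArcB → (shiftData E w).IsInEdge q.1 (q.2 + 1) → ∃ N : ℕ, n < N ∧ (∀ t ≤ N, E.IsInnerFace (cFace (cornerOrbit (E.bcBondConfig ω) a t))) ∧ (∀ s t, s < t → t ≤ N → cornerOrbit (E.bcBondConfig ω) a s ≠ cornerOrbit (E.bcBondConfig ω) a t) ∧ cornerOrbit (E.bcBondConfig ω) a N = (q.1 - w, q.2) :=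
  fun _ ω _ _ _ _ hE ha hStr hdeep hqA hqB hqIn => exists_returnJourney_W3H hE ω ha hStr hdeep hqA hqB hqIn

end

end Summit.CriticalPhenomena.CardyFormulaZ2.Cruxes.EdgePrecompact.QkzStripBoundaryArm
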